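import Summits.Ventures.YMGap.Thresholds.TwistedBochnerSU3
import HarnessLib

/-!
# Venture YMGap — the TRACE-NORM form of the `SU(3)` one-link Hessian split: `∑ D_αu D_βu D_αD_βS ≤ −(1/3)·S·Γ + (2/3)|c|‖B‖_op Γ`
# (duality `Re tr(PMQ) ≤ ‖P‖_tr‖M‖_op` for Hermitian `P`, unitary `Q`; `‖P‖_tr² ≤ (8/3)‖P‖_F²` for traceless Hermitian `3 × 3`)

HONEST FRAMING.  Venture file of the cell `pub-ymgap` (QuantumFields programme), seat engine-2 (g12); 0 compute.  Finite-dimensional matrix analysis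
on `M₃(ℂ) ⊃ SU(3)` feeding the strong-coupling one-link bookkeeping of lattice `SU(3)` Yang–Mills; no measure, no number of record in this file.
NOT weak coupling, NOT a continuum statement, NOT a Yang–Mills mass-gap claim.

WHAT.  g11's `TwistedBochnerSU3.hess_pot_le_su3` bounds the traceless part of the one-link Hessian word `c Re tr(g Z²₀ B)` (`Z²₀ = Z² + (‖Z‖²/3)·1`,
`Z = ∇u ∈ 𝔰𝔲(3)`) by the Hilbert–Schmidt Cauchy–Schwarz `‖Z²₀‖_F‖B‖_F = (‖Z‖²/√6)‖B‖_F ≤ (‖Z‖²/√2)‖B‖_op`.  The dual pairing is sharper: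
* `abs_re_trace_diagonal_conj_mul_le`, `re_trace_mul_le_sum_abs_eigenvalues_mul`: `Re tr(P M Q) ≤ (∑ᵢ|λᵢ(P)|)·‖M‖_op` for Hermitian `P`, unitary `Q`
  (spectral theorem `P = VΛV*`, `Λ = Λ₊ − Λ₋ = C₊² − C₋²`, Hilbert–Schmidt Cauchy–Schwarz on `C± · (C± V* M Q V)`, unitary invariance of `‖·‖_F`);
* `sum_eigenvalues_eq_and_sum_sq_eq`: `∑λᵢ = Re tr P`, `∑λᵢ² = ‖P‖_F²`; `sq_sum_abs_le_of_sum_eq_zero`: `(∑|pᵢ|)² ≤ (8/3)∑pᵢ²` when `p₁ + p₂ + p₃ = 0`;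
* `re_trace_tracelessSq_mul_le`: `Re tr(Z²₀ M Q) ≤ (2/3)‖Z‖_F²‖M‖_op` on `𝔰𝔲(3)` (`‖Z²₀‖_F² = ‖Z‖⁴/6`, g11's `frobNorm_sq_tracelessSq_su3`);
* ★ `hess_pot_le_su3_tr`: `∑ D_αu D_βu D_αD_βS (g) ≤ −(1/3)·S(g)·Γ(u,u)(g) + (2/3)|c|‖B‖_op Γ(u,u)(g)` for `S = c Re tr(·B)`, `g ∈ SU(3)` — the input of the
  trace-norm twisted constant `K₃ = 12/7 − (64/35)R` (sibling `TwistedBochnerSU3Trace`, through g12's `TwistedBochnerIntegrated.integral_twisted_bochner`).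
NOT CLAIMED: anything for `N ≠ 3` (for `N ≥ 4` the trace-norm split costs `2 − 4/N ≥ 1`); sharpness beyond the constant `2/3` (attained at `Z ∝ diag(i,−i,0)`).

References: R. Bhatia, *Matrix Analysis* (GTM 169) §IV.2 (duality of unitarily invariant norms); Shen–Zhu–Zhu CMP 400 (2023) Lemma 4.1; g11's
`TwistedBochnerSU3`; cell note `HOME/pub-ymgap-engine-2/TWISTED-BOCHNER-SUN.md` §4.
-/

noncomputable section

open scoped Matrix ComplexConjugate BigOperators Matrix.Norms.Frobenius ContDiff Topology
open Matrix Complex Finset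
open Literature.MathematicalPhysics.QuantumFieldTheory
open Literature.MathematicalPhysics.QuantumFieldTheory.SUNBakryEmery

namespace Summit.Ventures.YMGap.TwistedBochner


/-! ### 1. The dual pairing `Re tr(P M) ≤ ‖P‖_tr ‖M‖_op` for Hermitian `P` -/

section TraceNorm

variable {N : ℕ}

/-- `‖diag(d)‖_F² = ∑ |dᵢ|²`. [folklore] -/
theorem frobNorm_diagonal_sq (d : Fin N → ℂ) : frobNorm (diagonal d) ^ 2 = ∑ i, ‖d i‖ ^ 2 := by
  rw [frobNorm_sq]
  refine sum_congr rfl fun i _ => ?_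
  rw [sum_eq_single i (fun j _ hj => by rw [diagonal_apply_ne _ (Ne.symm hj), norm_zero, zero_pow two_ne_zero])
    (fun h => (h (mem_univ i)).elim), diagonal_apply_eq]

/-- For a nonnegative real tuple `a` and unitary `W, W'`, `|Re tr(diag(a) · W M W')| ≤ (∑ aᵢ) ‖M‖_op` (write `diag(a) = C²`, `C = diag(√a)`;
Hilbert–Schmidt Cauchy–Schwarz `|Re tr(C (C W M W'))| ≤ ‖C‖_F ‖C W M W'‖_F = ‖C‖_F ‖(C W) M‖_F ≤ ‖C‖_F² ‖M‖_op`). [folklore] -/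
theorem abs_re_trace_diagonal_conj_mul_le {a : Fin N → ℝ} (ha : ∀ i, 0 ≤ a i) {W W' : Matrix (Fin N) (Fin N) ℂ}
    (hW : W ∈ Matrix.unitaryGroup (Fin N) ℂ) (hW' : W' ∈ Matrix.unitaryGroup (Fin N) ℂ) (M : Matrix (Fin N) (Fin N) ℂ) :
    |(diagonal (fun i => (a i : ℂ)) * (W * M * W')).trace.re| ≤ (∑ i, a i) * matrixOpNorm M := by
  set C : Matrix (Fin N) (Fin N) ℂ := diagonal (fun i => ((Real.sqrt (a i) : ℝ) : ℂ)) with hC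
  have hCC : C * C = diagonal (fun i => (a i : ℂ)) := by
    rw [hC, diagonal_mul_diagonal]
    congr 1
    funext i
    rw [← Complex.ofReal_mul, Real.mul_self_sqrt (ha i)]
  have hCF : frobNorm C ^ 2 = ∑ i, a i := by
    rw [hC, frobNorm_diagonal_sq]
    refine sum_congr rfl fun i _ => ?_
    rw [Complex.norm_real, Real.norm_eq_abs, sq_abs, Real.sq_sqrt (ha i)]
  have hF : frobNorm (C * (W * M * W')) ≤ frobNorm C * matrixOpNorm M := by
    have e : C * (W * M * W') = C * W * M * W' := by simp only [Matrix.mul_assoc]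
    rw [e, frobNorm_mul_unitary _ hW']
    calc frobNorm (C * W * M) ≤ frobNorm (C * W) * matrixOpNorm M := frobNorm_mul_le_mul_matrixOpNorm _ _
      _ = frobNorm C * matrixOpNorm M := by rw [frobNorm_mul_unitary _ hW]
  rw [← hCC, Matrix.mul_assoc]
  calc |(C * (C * (W * M * W'))).trace.re| ≤ frobNorm C * frobNorm (C * (W * M * W')) := abs_re_trace_mul_le _ _
    _ ≤ frobNorm C * (frobNorm C * matrixOpNorm M) := mul_le_mul_of_nonneg_left hF (frobNorm_nonneg _)
    _ = (∑ i, a i) * matrixOpNorm M := by rw [← mul_assoc, ← sq, hCF]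

/-- **Duality of the trace norm (Hermitian case)**: `Re tr(P M Q) ≤ (∑ᵢ |λᵢ(P)|)·‖M‖_op` for Hermitian `P`, unitary `Q` (spectral theorem `P = VΛV*`,
`tr(PMQ) = tr(Λ · V*M(QV))` for unitary `Q`, `Λ = Λ₊ − Λ₋` and `abs_re_trace_diagonal_conj_mul_le`). [folklore] -/
theorem re_trace_mul_le_sum_abs_eigenvalues_mul {P : Matrix (Fin N) (Fin N) ℂ} (hP : P.IsHermitian) (M : Matrix (Fin N) (Fin N) ℂ)
    {Q : Matrix (Fin N) (Fin N) ℂ} (hQ : Q ∈ Matrix.unitaryGroup (Fin N) ℂ) :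
    (P * (M * Q)).trace.re ≤ (∑ i, |hP.eigenvalues i|) * matrixOpNorm M := by
  have hPeq' := hP.spectral_theorem
  rw [Unitary.conjStarAlgAut_apply] at hPeq'
  set V : Matrix (Fin N) (Fin N) ℂ := (hP.eigenvectorUnitary : Matrix (Fin N) (Fin N) ℂ) with hVdef
  set lam := hP.eigenvalues with hlam
  have hPeq : P = V * diagonal (fun i => (lam i : ℂ)) * star V := hPeq'
  have hVu : V ∈ Matrix.unitaryGroup (Fin N) ℂ := hP.eigenvectorUnitary.2
  have hVsu : star V ∈ Matrix.unitaryGroup (Fin N) ℂ := by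
    rw [hVdef, ← Unitary.coe_star]
    exact (star hP.eigenvectorUnitary).2
  have hQV : Q * V ∈ Matrix.unitaryGroup (Fin N) ℂ := Submonoid.mul_mem _ hQ hVu
  -- `tr(P M Q) = tr(Λ · V* M (Q V))`
  have htr : (P * (M * Q)).trace.re = (diagonal (fun i => (lam i : ℂ)) * (star V * M * (Q * V))).trace.re := by
    have e : P * (M * Q) = V * (diagonal (fun i => (lam i : ℂ)) * (star V * (M * Q))) := by
      rw [hPeq]; simp only [Matrix.mul_assoc]
    rw [e, trace_mul_comm]
    simp only [Matrix.mul_assoc]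
  -- `Λ = Λ₊ − Λ₋`
  have hsplit : diagonal (fun i => (lam i : ℂ)) =
      diagonal (fun i => ((max (lam i) 0 : ℝ) : ℂ)) - diagonal (fun i => ((max (-lam i) 0 : ℝ) : ℂ)) := by
    rw [diagonal_sub]
    congr 1
    funext i
    rw [← Complex.ofReal_sub]
    congr 1
    rcases le_total 0 (lam i) with h | h
    · rw [max_eq_left h, max_eq_right (by linarith), sub_zero]
    · rw [max_eq_right h, max_eq_left (by linarith)]; ring
  have hp := abs_re_trace_diagonal_conj_mul_le (a := fun i => max (lam i) 0) (fun i => le_max_right _ _) hVsu hQV M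
  have hm := abs_re_trace_diagonal_conj_mul_le (a := fun i => max (-lam i) 0) (fun i => le_max_right _ _) hVsu hQV M
  have habs : ∀ i, max (lam i) 0 + max (-lam i) 0 = |lam i| := by
    intro i
    rcases le_total 0 (lam i) with h | h
    · rw [max_eq_left h, max_eq_right (by linarith), abs_of_nonneg h, add_zero]
    · rw [max_eq_right h, max_eq_left (by linarith), abs_of_nonpos h, zero_add]
  have hsum : (∑ i, max (lam i) 0) + ∑ i, max (-lam i) 0 = ∑ i, |lam i| := by
    rw [← sum_add_distrib]
    exact sum_congr rfl fun i _ => habs i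
  rw [htr, hsplit, Matrix.sub_mul, trace_sub, Complex.sub_re]
  calc (diagonal (fun i => ((max (lam i) 0 : ℝ) : ℂ)) * (star V * M * (Q * V))).trace.re -
        (diagonal (fun i => ((max (-lam i) 0 : ℝ) : ℂ)) * (star V * M * (Q * V))).trace.re
      ≤ (∑ i, max (lam i) 0) * matrixOpNorm M + (∑ i, max (-lam i) 0) * matrixOpNorm M := by
        linarith [(abs_le.1 hp).2, (abs_le.1 hm).1]
    _ = (∑ i, |lam i|) * matrixOpNorm M := by rw [← hsum]; ring

/-- `∑ᵢ λᵢ(P) = Re tr P` and `∑ᵢ λᵢ(P)² = ‖P‖_F²` for Hermitian `P`. [folklore] -/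
theorem sum_eigenvalues_eq_and_sum_sq_eq {P : Matrix (Fin N) (Fin N) ℂ} (hP : P.IsHermitian) :
    (∑ i, hP.eigenvalues i) = P.trace.re ∧ (∑ i, hP.eigenvalues i ^ 2) = frobNorm P ^ 2 := by
  constructor
  · rw [hP.trace_eq_sum_eigenvalues]
    simp
  · have hPeq' := hP.spectral_theorem
    rw [Unitary.conjStarAlgAut_apply] at hPeq'
    set V : Matrix (Fin N) (Fin N) ℂ := (hP.eigenvectorUnitary : Matrix (Fin N) (Fin N) ℂ) with hVdef
    have hPeq : P = V * diagonal (fun i => (hP.eigenvalues i : ℂ)) * star V := hPeq'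
    have hVu : V ∈ Matrix.unitaryGroup (Fin N) ℂ := hP.eigenvectorUnitary.2
    have hVsu : star V ∈ Matrix.unitaryGroup (Fin N) ℂ := by
      rw [hVdef, ← Unitary.coe_star]
      exact (star hP.eigenvectorUnitary).2
    have h : frobNorm P = frobNorm (diagonal (fun i => (hP.eigenvalues i : ℂ))) := by
      have e := congrArg frobNorm hPeq
      rw [Matrix.mul_assoc, frobNorm_unitary_mul hVu, frobNorm_mul_unitary _ hVsu] at e
      exact e
    rw [h, frobNorm_diagonal_sq]
    refine sum_congr rfl fun i _ => ?_
    rw [Complex.norm_real, Real.norm_eq_abs, sq_abs]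

end TraceNorm

/-! ### 2. Traceless Hermitian `3 × 3`: `‖P‖_tr² ≤ (8/3)‖P‖_F²`, and the `𝔰𝔲(3)` pairing `Re tr(Z²₀ M) ≤ (2/3)‖Z‖²‖M‖_op` -/

/-- For real `d₀ + d₁ + d₂ = 0`: `(|d₀| + |d₁| + |d₂|)² ≤ (8/3)(d₀² + d₁² + d₂²)` (equality at `(1, 1, −2)`). [folklore] -/
theorem sq_sum_abs_le_of_sum_eq_zero (d : Fin 3 → ℝ) (h0 : ∑ i, d i = 0) :
    (∑ i, |d i|) ^ 2 ≤ 8 / 3 * ∑ i, d i ^ 2 := by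
  simp only [Fin.sum_univ_three] at h0 ⊢
  rcases le_total 0 (d 0) with h₀ | h₀ <;> rcases le_total 0 (d 1) with h₁ | h₁ <;> rcases le_total 0 (d 2) with h₂ | h₂ <;>
    simp only [abs_of_nonneg, abs_of_nonpos, h₀, h₁, h₂] <;>
    nlinarith [sq_nonneg (d 0 - d 1), sq_nonneg (d 1 - d 2), sq_nonneg (d 0 - d 2)]

/-- **The `𝔰𝔲(3)` pairing**: for `Zᴴ = −Z`, `tr Z = 0` (`3 × 3`), any `M` and unitary `Q`, `Re tr((Z² + (‖Z‖_F²/3)·1) M Q) ≤ (2/3)‖Z‖_F² ‖M‖_op`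
(`Z² + (‖Z‖²/3)·1` is traceless Hermitian with `‖·‖_F² = ‖Z‖⁴/6`, g11's `frobNorm_sq_tracelessSq_su3`; then `‖·‖_tr ≤ √(8/3)·‖Z‖²/√6 = (2/3)‖Z‖²`).
[folklore] -/
theorem re_trace_tracelessSq_mul_le {Z : Matrix (Fin 3) (Fin 3) ℂ} (hZ : Zᴴ = -Z) (hZ0 : Z.trace = 0) (M : Matrix (Fin 3) (Fin 3) ℂ)
    {Q : Matrix (Fin 3) (Fin 3) ℂ} (hQ : Q ∈ Matrix.unitaryGroup (Fin 3) ℂ) :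
    ((Z * Z + ((frobNorm Z ^ 2 / 3 : ℝ) : ℂ) • (1 : Matrix (Fin 3) (Fin 3) ℂ)) * (M * Q)).trace.re ≤
      2 / 3 * frobNorm Z ^ 2 * matrixOpNorm M := by
  set s : ℝ := frobNorm Z ^ 2 with hs
  set P : Matrix (Fin 3) (Fin 3) ℂ := Z * Z + ((s / 3 : ℝ) : ℂ) • (1 : Matrix (Fin 3) (Fin 3) ℂ) with hPdef
  have hs0 : 0 ≤ s := sq_nonneg _
  have hP : P.IsHermitian := by
    show Pᴴ = P
    rw [hPdef, conjTranspose_add, conjTranspose_mul, hZ, neg_mul_neg, conjTranspose_smul, conjTranspose_one, Complex.star_def,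
      Complex.conj_ofReal]
  have hPF : frobNorm P ^ 2 = s ^ 2 / 6 := by
    have h := frobNorm_sq_tracelessSq_su3 hZ hZ0
    rw [← hs] at h
    exact h
  have hPtr : P.trace.re = 0 := by
    have hZZ : (Z * Z).trace = -(s : ℂ) := by
      rw [trace_mul_eq_re_of_skew hZ hZ, hs, frobNorm_sq_of_skew hZ]
      push_cast
      ring
    have h0 : P.trace = 0 := by
      rw [hPdef, trace_add, trace_smul, trace_one, hZZ, Fintype.card_fin, smul_eq_mul]
      push_cast
      ring
    rw [h0, Complex.zero_re]
  obtain ⟨h1, h2⟩ := sum_eigenvalues_eq_and_sum_sq_eq hP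
  rw [hPtr] at h1
  rw [hPF] at h2
  have hsq := sq_sum_abs_le_of_sum_eq_zero hP.eigenvalues h1
  rw [h2] at hsq
  have hsum0 : 0 ≤ ∑ i, |hP.eigenvalues i| := sum_nonneg fun i _ => abs_nonneg _
  have htr : (∑ i, |hP.eigenvalues i|) ≤ 2 / 3 * s := by
    have e : (2 / 3 * s) ^ 2 = 8 / 3 * (s ^ 2 / 6) := by ring
    have hsq' : (∑ i, |hP.eigenvalues i|) ^ 2 ≤ (2 / 3 * s) ^ 2 := by rw [e]; exact hsq
    exact (pow_le_pow_iff_left₀ hsum0 (by positivity) two_ne_zero).1 hsq'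
  calc (P * (M * Q)).trace.re ≤ (∑ i, |hP.eigenvalues i|) * matrixOpNorm M := re_trace_mul_le_sum_abs_eigenvalues_mul hP M hQ
    _ ≤ 2 / 3 * s * matrixOpNorm M := mul_le_mul_of_nonneg_right htr (matrixOpNorm_nonneg M)

/-! ### 3. The Hessian split on `SU(3)` in trace-norm form -/

/-- **Hessian split on `SU(3)`, trace-norm form**: for `S = c Re tr(·B)`, smooth `u`, `g ∈ SU(3)`, with `Γ = Γ(u,u)(g)`:
`∑ D_αu D_βu D_αD_βS (g) ≤ −(1/3)·S(g)·Γ + (2/3)|c|‖B‖_op Γ` (isotropic third exact; traceless part by `re_trace_tracelessSq_mul_le`;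
g11's `hess_pot_le_su3` has `|c|‖B‖_F/√6 ≤ (|c|/√2)‖B‖_op` in place of `(2/3)|c|‖B‖_op`). [folklore] -/
theorem hess_pot_le_su3_tr (c : ℝ) (B : Matrix (Fin 3) (Fin 3) ℂ) (u : Matrix (Fin 3) (Fin 3) ℂ → ℝ) (g : SUN 3) :
    ∑ α, ∑ β, matD (frame α) u (g : Matrix (Fin 3) (Fin 3) ℂ) * matD (frame β) u (g : Matrix (Fin 3) (Fin 3) ℂ) *
        matD (frame α) (matD (frame β) (pot c B)) (g : Matrix (Fin 3) (Fin 3) ℂ) ≤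
      -(1 / ((3 : ℕ) : ℝ)) * (pot c B (g : Matrix (Fin 3) (Fin 3) ℂ) * Gam u u (g : Matrix (Fin 3) (Fin 3) ℂ)) +
        2 / 3 * (|c| * matrixOpNorm B) * Gam u u (g : Matrix (Fin 3) (Fin 3) ℂ) := by
  have h3 : (3 : ℕ) ≠ 0 := by norm_num
  have hQ := SUN.mem_unitaryGroup g
  set Q : Matrix (Fin 3) (Fin 3) ℂ := (g : Matrix (Fin 3) (Fin 3) ℂ) with hQdef
  set Z : Matrix (Fin 3) (Fin 3) ℂ := frameGrad (dirFun u Q) with hZdef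
  have hZ : Zᴴ = -Z := frameGrad_conjTranspose _
  have hZ0 : Z.trace = 0 := frameGrad_trace h3 _
  have hΓ : Gam u u Q = frobNorm Z ^ 2 := Gam_self_eq_frobNorm_sq h3 u Q
  set s : ℝ := frobNorm Z ^ 2 with hs
  have hs0 : 0 ≤ s := sq_nonneg _
  have hH : ∑ α, ∑ β, matD (frame α) u Q * matD (frame β) u Q * matD (frame α) (matD (frame β) (pot c B)) Q =
      c * (Q * Z * Z * B).trace.re := sum_sum_hess_potential c B u Q
  set P : Matrix (Fin 3) (Fin 3) ℂ := Z * Z + ((s / 3 : ℝ) : ℂ) • (1 : Matrix (Fin 3) (Fin 3) ℂ) with hPdef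
  -- the split of the Hessian word
  have hsplit : (Q * Z * Z * B).trace.re = (P * (B * Q)).trace.re - s / 3 * (Q * B).trace.re := by
    have e1 : Q * Z * Z * B = Q * P * B - ((s / 3 : ℝ) : ℂ) • (Q * B) := by
      rw [hPdef, Matrix.mul_add, Matrix.add_mul, Matrix.mul_smul, Matrix.mul_one, Matrix.smul_mul, Matrix.mul_assoc Q Z Z]
      abel
    have e2 : (Q * P * B).trace = (P * (B * Q)).trace := by
      rw [Matrix.mul_assoc, trace_mul_comm, Matrix.mul_assoc]
    rw [e1, trace_sub, trace_smul, e2, Complex.sub_re, smul_eq_mul, Complex.re_ofReal_mul]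
  -- the trace-norm bound on the traceless part, two-sided
  have hup : (P * (B * Q)).trace.re ≤ 2 / 3 * s * matrixOpNorm B := re_trace_tracelessSq_mul_le hZ hZ0 B hQ
  have hlo : -(2 / 3 * s * matrixOpNorm B) ≤ (P * (B * Q)).trace.re := by
    have h := re_trace_tracelessSq_mul_le hZ hZ0 (-B) hQ
    have e : matrixOpNorm (-B) = matrixOpNorm B := by
      rw [← neg_one_smul ℂ B, matrixOpNorm_smul, norm_neg, norm_one, one_mul]
    rw [Matrix.neg_mul, Matrix.mul_neg, trace_neg, Complex.neg_re, e] at h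
    linarith
  have hb' : c * (P * (B * Q)).trace.re ≤ |c| * (2 / 3 * s * matrixOpNorm B) := by
    calc c * (P * (B * Q)).trace.re ≤ |c * (P * (B * Q)).trace.re| := le_abs_self _
      _ = |c| * |(P * (B * Q)).trace.re| := abs_mul _ _
      _ ≤ |c| * (2 / 3 * s * matrixOpNorm B) := mul_le_mul_of_nonneg_left (abs_le.2 ⟨hlo, hup⟩) (abs_nonneg c)
  rw [hH, hsplit, hΓ]
  show c * ((P * (B * Q)).trace.re - s / 3 * (Q * B).trace.re) ≤
    -(1 / ((3 : ℕ) : ℝ)) * (c * (Q * B).trace.re * s) + 2 / 3 * (|c| * matrixOpNorm B) * s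
  push_cast
  nlinarith [hb']

end Summit.Ventures.YMGap.TwistedBochner

end
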